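import Mathlib
import HarnessLib

/-!
# Power–logarithm moments with a complex exponent: `∫ₐᵇ t^{β−1} dt` and `∫ₐᵇ t^{β−1} log t dt`

Topic `Literature/Analysis/SpecialFunctions`; namespace `Literature.Analysis.SpecialFunctions`.
Everything in this file is PROVED (no named fact, no axiom). Companion of `PowerLogMoments.lean` (real
exponent, endpoint `0`): here the exponent is COMPLEX, `β ∈ ℂ∖{0}`, and the interval `[a, b] ⊂ (0, ∞)`
stays away from `0`, so `t ↦ t^{β−1}` is smooth on it. The two table entries (Gradshteyn–Ryzhik 2.721 1
with `m = 0, 1`, taken between positive limits; the antiderivatives `t^β/β` and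
`t^β log t/β − t^β/β²` are the same formal expressions for complex `β`):

* `integral_cpow_sub_one'` — `∫ₐᵇ t^{β−1} dt = (b^β − a^β)/β` (`0 < a, b`; Mathlib's `integral_cpow`);
* `integral_cpow_sub_one_mul_log'` — `∫ₐᵇ t^{β−1} log t dt = (b^β log b − a^β log a)/β − (b^β − a^β)/β²`
  (`0 < a, b`), by parts (`u = log t`, `dv = t^{β−1}dt`, `v = t^β/β`);
* `integral_cpow_sub_one`, `integral_cpow_sub_one_mul_log` — the moments from `1`:
  `∫₁ˣ t^{β−1} dt = (X^β − 1)/β`, `∫₁ˣ t^{β−1} log t dt = X^β log X/β − (X^β − 1)/β²` (`0 < X`).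

Requested as LIB-QUEUE Q-26 of the ZHANG-L lane (WP12 closed forms); generic, no Zhang object.

## References

* I. S. Gradshteyn, I. M. Ryzhik, *Table of Integrals, Series, and Products*, 8th ed. (2015), 2.721 1
  (`∫ xⁿ lnᵐ x dx`, `m = 0, 1`), 2.723 1. [cite: GradshteynRyzhik2015, 2.721 1]
-/

noncomputable section

open Real Set MeasureTheory intervalIntegral
open scoped Interval

namespace Literature.Analysis.SpecialFunctions

/-- **`∫ₐᵇ t^{β−1} dt = (b^β − a^β)/β`** for complex `β ≠ 0` and `0 < a, b` (Gradshteyn–Ryzhik 2.721 1,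
`m = 0`, between positive limits; Mathlib's `integral_cpow`). [cite: GradshteynRyzhik2015, 2.721 1] -/
theorem integral_cpow_sub_one' {β : ℂ} (hβ : β ≠ 0) {a b : ℝ} (ha : 0 < a) (hb : 0 < b) :
    ∫ t in a..b, (t : ℂ) ^ (β - 1) = ((b : ℂ) ^ β - (a : ℂ) ^ β) / β := by
  have h0 : (0 : ℝ) ∉ [[a, b]] := by
    rw [Set.mem_uIcc]
    rintro (⟨h1, -⟩ | ⟨h1, -⟩)
    · exact absurd h1 (not_le.mpr ha)
    · exact absurd h1 (not_le.mpr hb)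
  have h := integral_cpow (a := a) (b := b) (r := β - 1) (Or.inr ⟨by simpa using hβ, h0⟩)
  simpa only [sub_add_cancel] using h

/-- **`∫ₐᵇ t^{β−1} log t dt = (b^β log b − a^β log a)/β − (b^β − a^β)/β²`** for complex `β ≠ 0` and
`0 < a, b` (Gradshteyn–Ryzhik 2.721 1 with `m = 1` / 2.723 1, between positive limits): integration by
parts with `u = log t`, `v = t^β/β`. [cite: GradshteynRyzhik2015, 2.721 1] -/
theorem integral_cpow_sub_one_mul_log' {β : ℂ} (hβ : β ≠ 0) {a b : ℝ} (ha : 0 < a) (hb : 0 < b) :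
    ∫ t in a..b, (t : ℂ) ^ (β - 1) * (Real.log t : ℂ) =
      ((b : ℂ) ^ β * (Real.log b : ℂ) - (a : ℂ) ^ β * (Real.log a : ℂ)) / β -
        ((b : ℂ) ^ β - (a : ℂ) ^ β) / β ^ 2 := by
  have hpos : ∀ x ∈ [[a, b]], 0 < x := fun x hx => by
    rcases Set.mem_uIcc.mp hx with ⟨h1, _⟩ | ⟨h1, _⟩
    · exact ha.trans_le h1
    · exact hb.trans_le h1
  have h0 : (0 : ℝ) ∉ [[a, b]] := fun h => lt_irrefl _ (hpos 0 h)
  -- `u = log`, `u' = t⁻¹`; `v = t^β/β`, `v' = t^{β−1}`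
  have hu : ∀ x ∈ [[a, b]], HasDerivAt (fun t : ℝ => (Real.log t : ℂ)) ((x : ℂ)⁻¹) x := by
    intro x hx
    have h := (Real.hasDerivAt_log (hpos x hx).ne').ofReal_comp
    simpa using h
  have hv : ∀ x ∈ [[a, b]], HasDerivAt (fun t : ℝ => (t : ℂ) ^ β / β) ((x : ℂ) ^ (β - 1)) x := by
    intro x hx
    have h := hasDerivAt_ofReal_cpow_const' (hpos x hx).ne' (r := β - 1) (by simpa using hβ)
    simpa only [sub_add_cancel] using h
  have hu' : IntervalIntegrable (fun x : ℝ => (x : ℂ)⁻¹) volume a b := by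
    refine ContinuousOn.intervalIntegrable ?_
    refine Complex.continuous_ofReal.continuousOn.inv₀ fun x hx => ?_
    exact_mod_cast (hpos x hx).ne'
  have hv' : IntervalIntegrable (fun x : ℝ => (x : ℂ) ^ (β - 1)) volume a b :=
    intervalIntegrable_cpow (Or.inr h0)
  have hparts := integral_mul_deriv_eq_deriv_mul hu hv hu' hv'
  -- the remaining integral `∫ t⁻¹ · t^β/β = (1/β) ∫ t^{β−1}`
  have hrest : ∫ x in a..b, (x : ℂ)⁻¹ * ((x : ℂ) ^ β / β) =
      β⁻¹ * (((b : ℂ) ^ β - (a : ℂ) ^ β) / β) := by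
    rw [← integral_cpow_sub_one' hβ ha hb, ← intervalIntegral.integral_const_mul]
    refine intervalIntegral.integral_congr fun x hx => ?_
    have hx0 : (x : ℂ) ≠ 0 := by exact_mod_cast (hpos x hx).ne'
    rw [Complex.cpow_sub _ _ hx0, Complex.cpow_one]
    field_simp
  calc ∫ t in a..b, (t : ℂ) ^ (β - 1) * (Real.log t : ℂ)
      = ∫ t in a..b, (Real.log t : ℂ) * (t : ℂ) ^ (β - 1) :=
        intervalIntegral.integral_congr fun x _ => mul_comm _ _
    _ = (Real.log b : ℂ) * ((b : ℂ) ^ β / β) - (Real.log a : ℂ) * ((a : ℂ) ^ β / β) -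
          ∫ x in a..b, (x : ℂ)⁻¹ * ((x : ℂ) ^ β / β) := hparts
    _ = _ := by rw [hrest]; field_simp

/-- **`∫₁ˣ t^{β−1} dt = (X^β − 1)/β`** for complex `β ≠ 0`, `X > 0`. [cite: GradshteynRyzhik2015, 2.721 1] -/
theorem integral_cpow_sub_one {β : ℂ} (hβ : β ≠ 0) {X : ℝ} (hX : 0 < X) :
    ∫ t in (1 : ℝ)..X, (t : ℂ) ^ (β - 1) = ((X : ℂ) ^ β - 1) / β := by
  rw [integral_cpow_sub_one' hβ one_pos hX, Complex.ofReal_one, Complex.one_cpow]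

/-- **`∫₁ˣ t^{β−1} log t dt = X^β log X/β − (X^β − 1)/β²`** for complex `β ≠ 0`, `X > 0` (by parts;
Gradshteyn–Ryzhik 2.721 1 / 2.723 1 between `1` and `X`). [cite: GradshteynRyzhik2015, 2.721 1] -/
theorem integral_cpow_sub_one_mul_log {β : ℂ} (hβ : β ≠ 0) {X : ℝ} (hX : 0 < X) :
    ∫ t in (1 : ℝ)..X, (t : ℂ) ^ (β - 1) * (Real.log t : ℂ) =
      (X : ℂ) ^ β * (Real.log X : ℂ) / β - ((X : ℂ) ^ β - 1) / β ^ 2 := by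
  rw [integral_cpow_sub_one_mul_log' hβ one_pos hX, Complex.ofReal_one, Complex.one_cpow,
    Real.log_one, Complex.ofReal_zero, mul_zero, sub_zero]

/-- The same two moments with the logarithm written on the left, `∫₁ˣ log t · t^{β−1} dt`.
[cite: GradshteynRyzhik2015, 2.721 1] -/
theorem integral_log_mul_cpow_sub_one {β : ℂ} (hβ : β ≠ 0) {X : ℝ} (hX : 0 < X) :
    ∫ t in (1 : ℝ)..X, (Real.log t : ℂ) * (t : ℂ) ^ (β - 1) =
      (X : ℂ) ^ β * (Real.log X : ℂ) / β - ((X : ℂ) ^ β - 1) / β ^ 2 := by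
  rw [← integral_cpow_sub_one_mul_log hβ hX]
  exact intervalIntegral.integral_congr fun x _ => mul_comm _ _

end Literature.Analysis.SpecialFunctions
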